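import Summits.Ventures.PackingBounds.Configurations.ListConfig

/-!
# Coordinate-list configurations checked against a KEY LIST (no common distance distribution needed)

Framing: lottery ticket; floor = certified bounds/negative ranges. Venture `PackingBounds` (cell
`pub-packcert`, seat `pub-packcert-recog`) — attained-side infrastructure.

`ListConfig.lean` (`histOK`) and `ListConfigTwoOrbit.lean` require every row of the coordinate list `L`
(resp. every row of each of two classes) to have one and the same dot-product HISTOGRAM; that is the right
tool for distance-regular sharp configurations and gives the energy identity. For a mere spherical-code
statement (cardinality, unit norms, all pairwise inner products `≤ s`) much less is needed: this file checks
only that every dot product of a row `v` with a member of `L.erase v` lies in a list `K` of admissible keys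
(`keysRowsOK L K rows`, chunkable in `rows`), for configurations with any number of point classes
(e.g. the Hardin–Smith–Sloane `24`-point code of `ℝ¹⁰` with maximal inner product `1/10`, which has four
different row histograms). Conclusions, for `L` over a commutative ring `R` with an injective
`ι : R →+* ℝ`, common self-dot-product `q` with `ι q > 0` and `q ∉ K`: `L.Nodup` (`nodup_of_keys`), the
configuration `config ι n q L` has `|L|` points (`card_eq_keys`), unit norms (`ListConfig.norm_eq_one`),
every inner product of two distinct points is `ι k / ι q` for a key `k ∈ K` (`inner_mem_keys`), hence
`≤ s` as soon as every key is (`inner_le_keys`); packaged as `exists_code_keys`. No new objects beyond the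
Boolean program `keysRowsOK`.
-/

namespace Summit.Ventures.PackingBounds.Config

open Finset WithLp

variable {R : Type*} [CommRing R] [DecidableEq R]

/-- Key check for a chunk of rows: every dot product of a checked row `v ∈ rows` with a member of
`L.erase v` is one of the keys `K`. -/
def keysRowsOK (L : List (List R)) (K : List R) (rows : List (List R)) : Bool :=
  rows.all fun v => ((L.erase v).map (dotL v)).all fun x => K.elem x

/-- `keysRowsOK` is multiplicative in the row list (chunking of big checks). -/
theorem keysRowsOK_append (L : List (List R)) (K : List R) (r₁ r₂ : List (List R)) :
    keysRowsOK L K (r₁ ++ r₂) = (keysRowsOK L K r₁ && keysRowsOK L K r₂) := by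
  simp [keysRowsOK, List.all_append]

variable {ι : R →+* ℝ} {n : ℕ} {q : R} {L rows : List (List R)} {K : List R}

/-- A checked row's dot products with the members of `L.erase` are keys. -/
theorem dot_mem_of_keysRowsOK (hK : keysRowsOK L K rows = true) {l l' : List R} (hl : l ∈ rows)
    (hl' : l' ∈ L.erase l) : dotL l l' ∈ K := by
  simp only [keysRowsOK, List.all_eq_true, List.mem_map] at hK
  have h := hK l hl (dotL l l') ⟨l', hl', rfl⟩
  simpa using h

/-- Dot products of two distinct members of `L` are keys. -/
theorem dot_mem_keys_of_ne (hK : keysRowsOK L K L = true) {l l' : List R} (hl : l ∈ L) (hl' : l' ∈ L)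
    (hne : l ≠ l') : dotL l l' ∈ K :=
  dot_mem_of_keysRowsOK hK hl ((List.mem_erase_of_ne (Ne.symm hne)).2 hl')

/-- The checks imply that `L` has no duplicate members: a duplicate of `a ∈ L` would survive in
`L.erase a` and show the non-key `a·a = q` as a dot product. -/
theorem nodup_of_keys (hS : shapeOK L n q = true) (hK : keysRowsOK L K L = true) (hq : q ∉ K) :
    L.Nodup := by
  rw [List.nodup_iff_count_le_one]
  intro a
  by_contra hlt
  push Not at hlt
  have ha : a ∈ L := List.count_pos_iff.1 (by omega)
  have ha2 : a ∈ L.erase a := by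
    rw [← List.count_pos_iff, List.count_erase_self]; omega
  have hkey := dot_mem_of_keysRowsOK hK ha ha2
  rw [dot_self_of_shapeOK hS ha] at hkey
  exact hq hkey

/-- `vec` is injective on `L` (distinct members have a key as dot product, and `q` is not a key). -/
theorem vec_injOn_keys (hι : Function.Injective ι) (hqp : 0 < ι q) (hS : shapeOK L n q = true)
    (hK : keysRowsOK L K L = true) (hq : q ∉ K) :
    ∀ l ∈ L, ∀ l' ∈ L, vec ι n q l = vec ι n q l' → l = l' := by
  intro l hl l' hl' he
  by_contra hne
  have hk := dot_mem_keys_of_ne hK hl hl' hne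
  have hin := inner_vec ι n q hqp l l' (length_of_shapeOK hS hl) (length_of_shapeOK hS hl')
  rw [he, real_inner_self_eq_norm_sq,
    norm_vec ι n q hqp l' (length_of_shapeOK hS hl') (dot_self_of_shapeOK hS hl'), one_pow,
    eq_div_iff hqp.ne', one_mul] at hin
  exact hq (hι hin ▸ hk)

/-- The configuration has `|L|` points. -/
theorem card_eq_keys (hι : Function.Injective ι) (hqp : 0 < ι q) (hS : shapeOK L n q = true)
    (hK : keysRowsOK L K L = true) (hq : q ∉ K) : (config ι n q L).card = L.length := by
  rw [config, List.toFinset_card_of_nodup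
    (((nodup_of_keys hS hK hq).map_on (vec_injOn_keys hι hqp hS hK hq))), List.length_map]

/-- Inner products of distinct points of the configuration are `ι k / ι q` for a key `k`. -/
theorem inner_mem_keys (hqp : 0 < ι q) (hS : shapeOK L n q = true) (hK : keysRowsOK L K L = true) :
    ∀ x ∈ config ι n q L, ∀ y ∈ config ι n q L, x ≠ y → ∃ k ∈ K, inner ℝ x y = ι k / ι q := by
  intro x hx y hy hxy
  obtain ⟨l, hl, rfl⟩ := mem_config.1 hx
  obtain ⟨l', hl', rfl⟩ := mem_config.1 hy
  have hne : l ≠ l' := fun h => hxy (by rw [h])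
  exact ⟨dotL l l', dot_mem_keys_of_ne hK hl hl' hne,
    inner_vec ι n q hqp l l' (length_of_shapeOK hS hl) (length_of_shapeOK hS hl')⟩

/-- Pairwise inner products are at most `s` as soon as every key is. -/
theorem inner_le_keys (hqp : 0 < ι q) (hS : shapeOK L n q = true) (hK : keysRowsOK L K L = true)
    (s : ℝ) (hs : ∀ k ∈ K, ι k / ι q ≤ s) :
    ∀ x ∈ config ι n q L, ∀ y ∈ config ι n q L, x ≠ y → inner ℝ x y ≤ s := by
  intro x hx y hy hxy
  obtain ⟨k, hk, he⟩ := inner_mem_keys hqp hS hK x hx y hy hxy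
  exact he ▸ hs k hk

/-- **Packaging.** A coordinate list passing `shapeOK` and `keysRowsOK L K L`, with `ι` injective,
`ι q > 0`, `q ∉ K` and every key `≤ s` after normalisation, gives `|L|` unit vectors of `ℝⁿ` with pairwise
inner products `≤ s`. -/
theorem exists_code_keys (hι : Function.Injective ι) (hqp : 0 < ι q) (hS : shapeOK L n q = true)
    (hK : keysRowsOK L K L = true) (hq : q ∉ K) (s : ℝ) (hs : ∀ k ∈ K, ι k / ι q ≤ s) :
    ∃ C : Finset (EuclideanSpace ℝ (Fin n)), C.card = L.length ∧
      (∀ x ∈ C, ‖x‖ = 1) ∧ ∀ x ∈ C, ∀ y ∈ C, x ≠ y → inner ℝ x y ≤ s :=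
  ⟨config ι n q L, card_eq_keys hι hqp hS hK hq, norm_eq_one hqp hS, inner_le_keys hqp hS hK s hs⟩

end Summit.Ventures.PackingBounds.Config
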